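import Literature.AlgebraicGeometry.Frobenioids.ArithmeticFrobenioidDivisorTransportSquareBase
import Literature.AlgebraicGeometry.Frobenioids.ArithmeticFrobenioidDivisorTransport
import Literature.AlgebraicGeometry.Frobenioids.ArithmeticRealificationInstance
import HarnessLib

/-!
# Frobenioids I, Theorem 6.4 (iii) for an ARBITRARY `Ψ′ : (C₁^pf)^un-tr ⥲ (C₂^pf)^un-tr` — the transport
# compatibility (G2) AT THE DATA `C_{K/F}` (row «T64iii-ARBITRARY-Ψ′», piece (G2′): the knit's hypothesis `hG2`)

Mochizuki, *The geometry of Frobenioids I: the general theory*, Kyushu J. Math. **62** (2008) 293–400, §6,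
Thm. 6.4 (iii) pp. 114–115 ("If the equivalence of categories `Ψ^rlf` of (ii) arises from an equivalence of
categories `(Ψ^pf)^un-tr : (C₁^pf)^un-tr ⥲ (C₂^pf)^un-tr` … [cf. (i) and Corollary 5.4] …"), proof p. 116 l. 4–16;
Cor. 4.11 (iii)/(iv) p. 92; Prop. 5.3 p. 103. [cite: MochizukiFrdI2008, Thm. 6.4 (iii) p.114]
[cite: MochizukiFrdI2008, Cor. 4.11 (iv) p.92] [cite: MochizukiFrdI2008, Prop. 5.3 p.103]

PROOF-ONLY companion (cell abc-iut, seat abc-iut-L1-d2 gen 5; row «T64iii-ARBITRARY-Ψ′», successor task (2) of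
abc-iut-L1-t3's knit `Thm64iii_arith_general_of_transportCompat`, whose single hypothesis `hG2` this file PROVES at
THE data).  Everything generic is abc-iut-L1-d2's `PreFrobenioidData.exists_baseIso_transport_compat_baseLetter`
(`ArithmeticFrobenioidDivisorTransportSquareBase.lean`); here its inputs are DISCHARGED at the arithmetic Frobenioids:

* `SU_i :=` the operations of THE unit-trivialised perfection `((C_{K_i/F_i})^pf)^un-tr`
  (`PreFrobenioidData.ofFunctor _ (untrFunctor (arith_pf_isFrobenioid F_i K_i))`, abc-iut-L1-d1), whose divisor
  monoid at `Spec L` IS `Φ_i(L)^pf`;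
* `SR_i := (arithRealification hΦ_i).ops`, the operations of THE realification `C_{K_i/F_i}^rlf` (Prop. 5.3), whose
  divisor monoid at `Spec L` is `Φ_i(L)^rlf`;
* `ι := Φ^pf → Φ^rlf` (`IsPerfFactorial.toRealification`), NATURAL in pull-backs (`arith_toRealification_pull`: the
  defining property `rlfMap_comp_toRealification` of `Φ^rlf(f)`);
* `Φ^rlf(L)` is SHARP (`IsPerfFactorial.Rlf.isSharp`), so isomorphisms of `C^rlf` have `Div = 0`;
* every `m ∈ Φ₁^pf(Base A)` is `Div(φ)` for an arrow `φ` out of `A` in `((C₁)^pf)^un-tr` (Def. 1.3 (iii)(d) for the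
  Frobenioid `((C₁)^pf)^un-tr`, `arith_pfUntr_div_surjective`).

RESULTS (the comparison functors `u_i : ((C_i)^pf)^un-tr → C_i^rlf` enter as BINDERS lying over `D_i` up to
`β_i : u_i ⋙ Base ≅ Base` with their Div-clause `Div(u_i φ) = β_i^* ι(Div φ)` — the schema `Thm64iii`'s own
parameters; `σ : Ψ′ ⋙ u₂ ≅ u₁ ⋙ Ψ^rlf` is print's hypothesis "arises from"):
* `arith_transportCompat_baseLetter_of_square` — for ANY `θ : Φ₁^pf(Base u₁A₁) → Φ₂^pf(Base u₂Ψ′A₁)` with the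
  `β`-conjugated Div-clause and EVERY Cor. 4.11 datum `(Ψ^Base, E, η)` of `Ψ^rlf` with its Div-clause:
  `∃ γ : Base(u₂Ψ′A₁) ≅ Ψ^Base(Base u₁A₁)`, `γ = Base(σ_{A₁}) ≫ η_{u₁A₁}`, `ι(θ x) = γ^* E(ι x)` for all `x`;
* `arith_hG2_of_square` — the same in the EXACT letter of the knit's hypothesis `hG2`;
* `arith_hG2_of_square_of_divClause` — for `θ` in the PLAIN letter `θ(Div φ) = Div(Ψ′φ)` (abc-iut-L1-d1's
  `exists_perfectedDivisorTransport_pfUntr_at_arith Ψ′ A₁`), about its `β`-conjugate.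
No `def`, no instance, no named fact.  Nothing here bears on, or takes a side on, [IUTchIII] Cor. 3.12; no statement of
the paper is strengthened.
-/

noncomputable section

namespace Literature.AlgebraicGeometry.Frobenioids

open CategoryTheory Opposite PreFrobenioid Literature.AnabelianGeometry.EtaleTheta

section Arith

variable {F₁ : Type} [Field F₁] [NumberField F₁] {K₁ : Type} [Field K₁] [Algebra F₁ K₁] [IsGalois F₁ K₁]
  {F₂ : Type} [Field F₂] [NumberField F₂] {K₂ : Type} [Field K₂] [Algebra F₂ K₂] [IsGalois F₂ K₂]
  (hΦ₁ : PreFrobenioid.IsPerfFactorialOn (arithDivisorFunctor F₁ K₁))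
  (hΦ₂ : PreFrobenioid.IsPerfFactorialOn (arithDivisorFunctor F₂ K₂))

/-! ### The inputs of the generic (G2) letter, discharged at `C_{K/F}` -/

/-- **`ι : Φ^pf → Φ^rlf` is natural in pull-backs** between the operations of `((C_{K/F})^pf)^un-tr` and of
`C_{K/F}^rlf` (the defining property of `Φ^rlf(f)`, Prop. 5.3). [cite: MochizukiFrdI2008, Prop. 5.3 p.103] -/
theorem arith_toRealification_pull {X Y : FinSubextCat F₁ K₁} (f : Y ⟶ X)
    (m : (PreFrobenioidData.ofFunctor _ (untrFunctor (arith_pf_isFrobenioid F₁ K₁))).Mon X) :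
    (PreFrobenioid.IsPerfFactorialOn.op hΦ₁ (op Y)).toRealification
        ((PreFrobenioidData.ofFunctor _ (untrFunctor (arith_pf_isFrobenioid F₁ K₁))).pull f m) =
      (arithRealification hΦ₁).ops.pull f ((PreFrobenioid.IsPerfFactorialOn.op hΦ₁ (op X)).toRealification m) := by
  have h := DFunLike.congr_fun
    (rlfMap_comp_toRealification (arithDivisorFunctor F₁ K₁) (PreFrobenioid.IsPerfFactorialOn.op hΦ₁) f.op) m
  exact h.symm

omit [IsGalois F₁ K₁] in
/-- **`Φ^rlf(L)` is sharp** at every object of `D` (for the operations of `C_{K/F}^rlf`).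
[cite: MochizukiFrdI2008, Def. 2.4 (i) p.48] -/
theorem arith_rlf_mon_isSharp (Y : FinSubextCat F₁ K₁) : IsSharp ((arithRealification hΦ₁).ops.Mon Y) :=
  IsPerfFactorial.Rlf.isSharp (PreFrobenioid.IsPerfFactorialOn.op hΦ₁ (op Y))

/-- **Def. 1.3 (iii)(d) for the Frobenioid `((C_{K/F})^pf)^un-tr`**: every `m ∈ Φ^pf(Base A)` is `Div(φ)` for an
arrow `φ` out of `A`. [cite: MochizukiFrdI2008, Def. 1.3 (iii) p.24] -/
theorem arith_pfUntr_div_surjective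
    (A : (PreFrobenioidData.ofFunctor _
      (PreFrobenioid.Perfection.ops (arithFrobenioid_isFrobenioid F₁ K₁)).toFunctor).Untr)
    (m : (PreFrobenioidData.ofFunctor _ (untrFunctor (arith_pf_isFrobenioid F₁ K₁))).Mon
      ((PreFrobenioidData.ofFunctor _ (untrFunctor (arith_pf_isFrobenioid F₁ K₁))).base.obj A)) :
    ∃ (B : (PreFrobenioidData.ofFunctor _
        (PreFrobenioid.Perfection.ops (arithFrobenioid_isFrobenioid F₁ K₁)).toFunctor).Untr) (φ : A ⟶ B),
      (PreFrobenioidData.ofFunctor _ (untrFunctor (arith_pf_isFrobenioid F₁ K₁))).div φ = m := by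
  obtain ⟨B, φ, -, h⟩ := (isFrobenioid_untr (arith_pf_isFrobenioid F₁ K₁)).iii_d_under_surj A m
  exact ⟨B, φ, h⟩

/-! ### (G2) at the data: the knit's hypothesis `hG2` -/

variable
  (Ψr : PreFrobenioid.rlf (ModelFrobenioid.toElem (arithDivisorFunctor F₁ K₁) (unitsFunctor F₁ K₁)
      (divNatTrans F₁ K₁)) hΦ₁ ⥤
    PreFrobenioid.rlf (ModelFrobenioid.toElem (arithDivisorFunctor F₂ K₂) (unitsFunctor F₂ K₂)
      (divNatTrans F₂ K₂)) hΦ₂)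
  -- the comparison functors `u_i : ((C_i)^pf)^un-tr → C_i^rlf`, over `D_i` up to `β_i`, with their Div-clauses
  (u₁ : (PreFrobenioidData.ofFunctor _
      (PreFrobenioid.Perfection.ops (arithFrobenioid_isFrobenioid F₁ K₁)).toFunctor).Untr ⥤
    PreFrobenioid.rlf (ModelFrobenioid.toElem (arithDivisorFunctor F₁ K₁) (unitsFunctor F₁ K₁)
      (divNatTrans F₁ K₁)) hΦ₁)
  (β₁ : u₁ ⋙ (arithRealification hΦ₁).ops.base ≅
    (PreFrobenioidData.ofFunctor _ (untrFunctor (arith_pf_isFrobenioid F₁ K₁))).base)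
  (hu₁ : ∀ ⦃A B : (PreFrobenioidData.ofFunctor _
      (PreFrobenioid.Perfection.ops (arithFrobenioid_isFrobenioid F₁ K₁)).toFunctor).Untr⦄ (φ : A ⟶ B),
    (arithRealification hΦ₁).ops.div (u₁.map φ) =
      (arithRealification hΦ₁).ops.pull (β₁.hom.app A)
        ((PreFrobenioid.IsPerfFactorialOn.op hΦ₁ (op _)).toRealification
          ((PreFrobenioidData.ofFunctor _ (untrFunctor (arith_pf_isFrobenioid F₁ K₁))).div φ)))
  (u₂ : (PreFrobenioidData.ofFunctor _
      (PreFrobenioid.Perfection.ops (arithFrobenioid_isFrobenioid F₂ K₂)).toFunctor).Untr ⥤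
    PreFrobenioid.rlf (ModelFrobenioid.toElem (arithDivisorFunctor F₂ K₂) (unitsFunctor F₂ K₂)
      (divNatTrans F₂ K₂)) hΦ₂)
  (β₂ : u₂ ⋙ (arithRealification hΦ₂).ops.base ≅
    (PreFrobenioidData.ofFunctor _ (untrFunctor (arith_pf_isFrobenioid F₂ K₂))).base)
  (hu₂ : ∀ ⦃A B : (PreFrobenioidData.ofFunctor _
      (PreFrobenioid.Perfection.ops (arithFrobenioid_isFrobenioid F₂ K₂)).toFunctor).Untr⦄ (φ : A ⟶ B),
    (arithRealification hΦ₂).ops.div (u₂.map φ) =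
      (arithRealification hΦ₂).ops.pull (β₂.hom.app A)
        ((PreFrobenioid.IsPerfFactorialOn.op hΦ₂ (op _)).toRealification
          ((PreFrobenioidData.ofFunctor _ (untrFunctor (arith_pf_isFrobenioid F₂ K₂))).div φ)))
  (Ψ' : (PreFrobenioidData.ofFunctor _
      (PreFrobenioid.Perfection.ops (arithFrobenioid_isFrobenioid F₁ K₁)).toFunctor).Untr ⥤
    (PreFrobenioidData.ofFunctor _
      (PreFrobenioid.Perfection.ops (arithFrobenioid_isFrobenioid F₂ K₂)).toFunctor).Untr)
  (σ : Ψ' ⋙ u₂ ≅ u₁ ⋙ Ψr)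
  (A₁ : (PreFrobenioidData.ofFunctor _
    (PreFrobenioid.Perfection.ops (arithFrobenioid_isFrobenioid F₁ K₁)).toFunctor).Untr)

include hu₁ hu₂ σ

/-- **(G2) AT THE DATA, base letter.**  For `Ψ^r : C₁^rlf → C₂^rlf`, comparison functors `u_i` over `D_i` up to
`β_i` with Div-clauses `Div(u_i φ) = β_i^* ι(Div φ)`, a square `σ : Ψ′ ⋙ u₂ ≅ u₁ ⋙ Ψ^r`, an object `A₁` of
`((C₁)^pf)^un-tr` and ANY `θ : Φ₁^pf(Base u₁A₁) → Φ₂^pf(Base u₂Ψ′A₁)` with `θ(β₁^* Div φ) = β₂^* Div(Ψ′φ)` on arrows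
out of `A₁`: for EVERY Cor. 4.11 datum `(Ψ^Base, E, η)` of `Ψ^r` with its Div-clause there is
`γ : Base(u₂Ψ′A₁) ≅ Ψ^Base(Base u₁A₁)`, `γ = Base(σ_{A₁}) ≫ η_{u₁A₁}`, with `ι(θ x) = γ^* E(ι x)` for all
`x ∈ Φ₁^pf(Base u₁A₁)` — "the bijection … induced by `(Ψ^pf)^un-tr`" agrees with `Ψ^rlf`'s divisor transport
(p. 116 l. 4–16 uses exactly this). [cite: MochizukiFrdI2008, Thm. 6.4 (iii) p.114] -/
theorem arith_transportCompat_baseLetter_of_square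
    (θ : (PreFrobenioidData.ofFunctor _ (untrFunctor (arith_pf_isFrobenioid F₁ K₁))).Mon
        ((arithRealification hΦ₁).ops.base.obj (u₁.obj A₁)) →
      (PreFrobenioidData.ofFunctor _ (untrFunctor (arith_pf_isFrobenioid F₂ K₂))).Mon
        ((arithRealification hΦ₂).ops.base.obj (u₂.obj (Ψ'.obj A₁))))
    (hθ : ∀ ⦃B : (PreFrobenioidData.ofFunctor _
        (PreFrobenioid.Perfection.ops (arithFrobenioid_isFrobenioid F₁ K₁)).toFunctor).Untr⦄ (φ : A₁ ⟶ B),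
      θ ((PreFrobenioidData.ofFunctor _ (untrFunctor (arith_pf_isFrobenioid F₁ K₁))).pull (β₁.hom.app A₁)
          ((PreFrobenioidData.ofFunctor _ (untrFunctor (arith_pf_isFrobenioid F₁ K₁))).div φ)) =
        (PreFrobenioidData.ofFunctor _ (untrFunctor (arith_pf_isFrobenioid F₂ K₂))).pull (β₂.hom.app (Ψ'.obj A₁))
          ((PreFrobenioidData.ofFunctor _ (untrFunctor (arith_pf_isFrobenioid F₂ K₂))).div (Ψ'.map φ)))
    (ΨBase : FinSubextCat F₁ K₁ ⥤ FinSubextCat F₂ K₂)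
    (E : PreFrobenioidData.DivisorMonoidIsoOverBase (arithRealification hΦ₁).ops (arithRealification hΦ₂).ops ΨBase)
    (η : Ψr ⋙ (arithRealification hΦ₂).ops.base ≅ (arithRealification hΦ₁).ops.base ⋙ ΨBase)
    (hdiv : ∀ ⦃A B⦄ (φ : A ⟶ B), (arithRealification hΦ₂).ops.div (Ψr.map φ) =
      (arithRealification hΦ₂).ops.pull (η.hom.app A)
        (E.iso ((arithRealification hΦ₁).ops.base.obj A) ((arithRealification hΦ₁).ops.div φ))) :
    ∃ γ : (arithRealification hΦ₂).ops.base.obj (u₂.obj (Ψ'.obj A₁)) ≅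
        ΨBase.obj ((arithRealification hΦ₁).ops.base.obj (u₁.obj A₁)),
      γ.hom = (arithRealification hΦ₂).ops.base.map (σ.hom.app A₁) ≫ η.hom.app (u₁.obj A₁) ∧
      ∀ x : (PreFrobenioidData.ofFunctor _ (untrFunctor (arith_pf_isFrobenioid F₁ K₁))).Mon
          ((arithRealification hΦ₁).ops.base.obj (u₁.obj A₁)),
        (PreFrobenioid.IsPerfFactorialOn.op hΦ₂ (op ((arithRealification hΦ₂).ops.base.obj
            (u₂.obj (Ψ'.obj A₁))))).toRealification (θ x) =
          (arithRealification hΦ₂).ops.pull γ.hom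
            (E.iso ((arithRealification hΦ₁).ops.base.obj (u₁.obj A₁))
              ((PreFrobenioid.IsPerfFactorialOn.op hΦ₁ (op ((arithRealification hΦ₁).ops.base.obj
                (u₁.obj A₁)))).toRealification x)) :=
  PreFrobenioidData.exists_baseIso_transport_compat_baseLetter
    (PreFrobenioidData.ofFunctor _ (untrFunctor (arith_pf_isFrobenioid F₁ K₁)))
    (PreFrobenioidData.ofFunctor _ (untrFunctor (arith_pf_isFrobenioid F₂ K₂)))
    (arithRealification hΦ₁).ops (arithRealification hΦ₂).ops
    (fun X => (PreFrobenioid.IsPerfFactorialOn.op hΦ₁ (op X)).toRealification)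
    (fun X => (PreFrobenioid.IsPerfFactorialOn.op hΦ₂ (op X)).toRealification)
    (fun _ _ f m => arith_toRealification_pull hΦ₁ f m) (fun _ _ f m => arith_toRealification_pull hΦ₂ f m)
    u₁ β₁ hu₁ u₂ β₂ hu₂ Ψ' Ψr ΨBase E η hdiv σ (arith_rlf_mon_isSharp hΦ₂) A₁ θ hθ
    (arith_pfUntr_div_surjective A₁)

/-- **(G2) AT THE DATA in the EXACT letter of the knit's hypothesis `hG2`** (abc-iut-L1-t3's
`Thm64iii_arith_general_of_transportCompat`): for every Cor. 4.11 datum `(Ψ^Base, E, η)` of `Ψ^r` (an equivalence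
`Ψ^Base` — idle here) with its Div-clause, `∃ γ, ∀ x, ι(θ x) = γ^* E(ι x)`. [cite: MochizukiFrdI2008, Thm. 6.4 (iii) p.114] -/
theorem arith_hG2_of_square
    (θ : (PreFrobenioidData.ofFunctor _ (untrFunctor (arith_pf_isFrobenioid F₁ K₁))).Mon
        ((arithRealification hΦ₁).ops.base.obj (u₁.obj A₁)) →
      (PreFrobenioidData.ofFunctor _ (untrFunctor (arith_pf_isFrobenioid F₂ K₂))).Mon
        ((arithRealification hΦ₂).ops.base.obj (u₂.obj (Ψ'.obj A₁))))
    (hθ : ∀ ⦃B : (PreFrobenioidData.ofFunctor _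
        (PreFrobenioid.Perfection.ops (arithFrobenioid_isFrobenioid F₁ K₁)).toFunctor).Untr⦄ (φ : A₁ ⟶ B),
      θ ((PreFrobenioidData.ofFunctor _ (untrFunctor (arith_pf_isFrobenioid F₁ K₁))).pull (β₁.hom.app A₁)
          ((PreFrobenioidData.ofFunctor _ (untrFunctor (arith_pf_isFrobenioid F₁ K₁))).div φ)) =
        (PreFrobenioidData.ofFunctor _ (untrFunctor (arith_pf_isFrobenioid F₂ K₂))).pull (β₂.hom.app (Ψ'.obj A₁))
          ((PreFrobenioidData.ofFunctor _ (untrFunctor (arith_pf_isFrobenioid F₂ K₂))).div (Ψ'.map φ)))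
    (ΨBase : FinSubextCat F₁ K₁ ⥤ FinSubextCat F₂ K₂) [ΨBase.IsEquivalence]
    (E : PreFrobenioidData.DivisorMonoidIsoOverBase (arithRealification hΦ₁).ops (arithRealification hΦ₂).ops ΨBase)
    (η : Ψr ⋙ (arithRealification hΦ₂).ops.base ≅ (arithRealification hΦ₁).ops.base ⋙ ΨBase)
    (hdiv : ∀ ⦃A B⦄ (φ : A ⟶ B), (arithRealification hΦ₂).ops.div (Ψr.map φ) =
      (arithRealification hΦ₂).ops.pull (η.hom.app A)
        (E.iso ((arithRealification hΦ₁).ops.base.obj A) ((arithRealification hΦ₁).ops.div φ))) :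
    ∃ γ : (arithRealification hΦ₂).ops.base.obj (u₂.obj (Ψ'.obj A₁)) ≅
        ΨBase.obj ((arithRealification hΦ₁).ops.base.obj (u₁.obj A₁)),
      ∀ x : Perfection (Multiplicative (EffArithDivisor ((arithRealification hΦ₁).ops.base.obj (u₁.obj A₁)).L)),
        (PreFrobenioid.IsPerfFactorialOn.op hΦ₂ (op ((arithRealification hΦ₂).ops.base.obj
            (u₂.obj (Ψ'.obj A₁))))).toRealification (θ x) =
          (arithRealification hΦ₂).ops.pull γ.hom
            (E.iso ((arithRealification hΦ₁).ops.base.obj (u₁.obj A₁))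
              ((PreFrobenioid.IsPerfFactorialOn.op hΦ₁ (op ((arithRealification hΦ₁).ops.base.obj
                (u₁.obj A₁)))).toRealification x)) :=
  (arith_transportCompat_baseLetter_of_square hΦ₁ hΦ₂ Ψr u₁ β₁ hu₁ u₂ β₂ hu₂ Ψ' σ A₁ θ hθ ΨBase E η hdiv).imp
    fun _ h => h.2

/-- **(G2) AT THE DATA for `θ` in the PLAIN letter** `θ(Div φ) = Div(Ψ′φ)` (abc-iut-L1-d1's perfected divisor
transport `exists_perfectedDivisorTransport_pfUntr_at_arith Ψ′ A₁`, over `Base A₁` / `Base Ψ′A₁`): its `β`-conjugate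
`x ↦ β₂^* θ((β₁⁻¹)^* x)` (over the bases of the `u_i`-images) satisfies the knit's `hG2`.
[cite: MochizukiFrdI2008, Thm. 6.4 (iii) p.115] -/
theorem arith_hG2_of_square_of_divClause
    (θ : (PreFrobenioidData.ofFunctor _ (untrFunctor (arith_pf_isFrobenioid F₁ K₁))).Mon
        ((PreFrobenioidData.ofFunctor _ (untrFunctor (arith_pf_isFrobenioid F₁ K₁))).base.obj A₁) →
      (PreFrobenioidData.ofFunctor _ (untrFunctor (arith_pf_isFrobenioid F₂ K₂))).Mon
        ((PreFrobenioidData.ofFunctor _ (untrFunctor (arith_pf_isFrobenioid F₂ K₂))).base.obj (Ψ'.obj A₁)))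
    (hθ : ∀ ⦃B : (PreFrobenioidData.ofFunctor _
        (PreFrobenioid.Perfection.ops (arithFrobenioid_isFrobenioid F₁ K₁)).toFunctor).Untr⦄ (φ : A₁ ⟶ B),
      θ ((PreFrobenioidData.ofFunctor _ (untrFunctor (arith_pf_isFrobenioid F₁ K₁))).div φ) =
        (PreFrobenioidData.ofFunctor _ (untrFunctor (arith_pf_isFrobenioid F₂ K₂))).div (Ψ'.map φ))
    (ΨBase : FinSubextCat F₁ K₁ ⥤ FinSubextCat F₂ K₂) [ΨBase.IsEquivalence]
    (E : PreFrobenioidData.DivisorMonoidIsoOverBase (arithRealification hΦ₁).ops (arithRealification hΦ₂).ops ΨBase)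
    (η : Ψr ⋙ (arithRealification hΦ₂).ops.base ≅ (arithRealification hΦ₁).ops.base ⋙ ΨBase)
    (hdiv : ∀ ⦃A B⦄ (φ : A ⟶ B), (arithRealification hΦ₂).ops.div (Ψr.map φ) =
      (arithRealification hΦ₂).ops.pull (η.hom.app A)
        (E.iso ((arithRealification hΦ₁).ops.base.obj A) ((arithRealification hΦ₁).ops.div φ))) :
    ∃ γ : (arithRealification hΦ₂).ops.base.obj (u₂.obj (Ψ'.obj A₁)) ≅
        ΨBase.obj ((arithRealification hΦ₁).ops.base.obj (u₁.obj A₁)),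
      ∀ x : Perfection (Multiplicative (EffArithDivisor ((arithRealification hΦ₁).ops.base.obj (u₁.obj A₁)).L)),
        (PreFrobenioid.IsPerfFactorialOn.op hΦ₂ (op ((arithRealification hΦ₂).ops.base.obj
            (u₂.obj (Ψ'.obj A₁))))).toRealification
            ((PreFrobenioidData.ofFunctor _ (untrFunctor (arith_pf_isFrobenioid F₂ K₂))).pull (β₂.hom.app (Ψ'.obj A₁))
              (θ ((PreFrobenioidData.ofFunctor _ (untrFunctor (arith_pf_isFrobenioid F₁ K₁))).pull (β₁.inv.app A₁)
                x))) =
          (arithRealification hΦ₂).ops.pull γ.hom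
            (E.iso ((arithRealification hΦ₁).ops.base.obj (u₁.obj A₁))
              ((PreFrobenioid.IsPerfFactorialOn.op hΦ₁ (op ((arithRealification hΦ₁).ops.base.obj
                (u₁.obj A₁)))).toRealification x)) :=
  (PreFrobenioidData.exists_baseIso_transport_compat_baseLetter_of_divClause
    (PreFrobenioidData.ofFunctor _ (untrFunctor (arith_pf_isFrobenioid F₁ K₁)))
    (PreFrobenioidData.ofFunctor _ (untrFunctor (arith_pf_isFrobenioid F₂ K₂)))
    (arithRealification hΦ₁).ops (arithRealification hΦ₂).ops
    (fun X => (PreFrobenioid.IsPerfFactorialOn.op hΦ₁ (op X)).toRealification)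
    (fun X => (PreFrobenioid.IsPerfFactorialOn.op hΦ₂ (op X)).toRealification)
    (fun _ _ f m => arith_toRealification_pull hΦ₁ f m) (fun _ _ f m => arith_toRealification_pull hΦ₂ f m)
    u₁ β₁ hu₁ u₂ β₂ hu₂ Ψ' Ψr ΨBase E η hdiv σ (arith_rlf_mon_isSharp hΦ₂) A₁ θ hθ
    (arith_pfUntr_div_surjective A₁)).imp fun _ h => h.2

end Arith

end Literature.AlgebraicGeometry.Frobenioids

end
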